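import Summits.QuantumFields.BalabanUV.Beta.FP.PeriodisedBorderIndexWardTwo
import Summits.QuantumFields.BalabanUV.Beta.FP.TorusCompositeCovarianceTwo
import Summits.QuantumFields.BalabanUV.Beta.FP.TorusCompositeIndexWardOne

/-!
# `BalabanUV.Beta.FP.TorusCompositeIndexWardTwo` — road «FP» for binder row D1, ROUTE T, (T-β-m) ORDER 2 AT EVERY DEPTH, PART 2:
# **THE ONE-STEP AND THE COMPOSITE SECOND-ORDER INSERTION JETS ALONG A GAUGE-SHIFTED DIRECTION** — `stepIns₂ (w + σ•Dμ)` (PART 1's torus index law at C1's slot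
# maps) and, by induction over my g25 I-4's ♭ second chain rule, **`compIns₂ … n (h + Dλ) = compIns₂ … n h + 2·(R·compIns₁ … n h − compIns₁ … n h·E) + (R(RC − CE) − (RC − CE)E)`**
# (`C = compRows … n`, `E = diagonal (λ b.1)`, `R = diagonal (λ (itRoot n a.1))`; NO constants — the ♭ recursion is EXACTLY gauge-covariant at order 2)

WHY.  #21's `q2` letter BY TERM (the sequel `FP/TorusCompositeIndexWardTwoLetter.torus_q2_tower`) needs, besides g22's ORDER-1 shift `compIns₁_pureGauge_fun`, the
ORDER-2 shift of OUR composite jet `compIns₂` (I-4): the value of a quadratic jet at `h + Dλ` is its value at `h` plus the polarised cross term plus its value at the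
pure gauge; PART 1 (`PeriodisedBorderIndexWardTwo`) supplies both for ONE step, and the ♭ recursion carries them up the tower: at the induction step the top step's
second jet along the transported direction `C(h + Dλ) = Ch + σ_n•D(λ∘itRoot n)` meets `(θ_n∕σ_n)·σ_n = θ_n` (cross) and `(θ_n∕σ_n)·σ_n²·c_{lev 1} = 1` (gauge–gauge),
the cross summand meets `2θ_n·σ_n·c_{lev 1} = 2`, and every `R_low`-term cancels between the three summands.

WHAT.  §1 (one step, torus `F = fine Lc M`, root `r ∈ box`, C1's slot maps): `sum_tdelta_coarsePt_add` (the multiplier rotates at `rootPt`), PART 1's bi-weighted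
forms at C1's slot maps `torus_T2_gauge_fst ∕ snd`, `stepIns₁_shift_smul_fun`, and **`stepIns₂_shift_smul_fun`**:
`stepIns₂ (w + σ•Dμ) = stepIns₂ w + σ•((R_μ·stepIns₁ w − stepIns₁ w·E_μ) + (same)) + (σ·σ·c_ℓ)•(R_μ(R_μ Q − Q E_μ) − (R_μ Q − Q E_μ)E_μ)` (`Q = Qstep_ℓ`,
`R_μ = diagonal (μ (rootPt a.1))`, `E_μ = diagonal (μ b.1)`, `c_ℓ = (Lc^{d+1}·stepScale d Lc ℓ)⁻¹`).  §2 (tower, push-inside types, g22's induction pattern):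
`compIns₂_pureGauge_shift_step` and **`compIns₂_pureGauge_shift`**.  [folklore] finite sums + matrix algebra BY NAME; no `def`, no `def … : Prop`, nothing cited,
0 sorry.  Nothing of the dictionary ∕ Bałaban's asserted (the ♭ recursion is DEFINITIONAL for OUR `compIns₂` and CANDIDATE, R-FP-63 (v)).

HONEST DEPENDENCY (page 1, mandatory): continuum YM on T⁴ ⇐ BetaPertH ∧ nine spine estimates (0/9 proved); BetaPertH ⇐ (D1) ∧ (D4) ∧ CAP+tail;
G-an2-4 gates asym, D1 and NE2/3/4.  HONEST FRAMING (cell contract, verbatim): «discharging `BetaPertH` makes Bałaban's UV stability UNCONDITIONAL —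
a real constructive-QFT result; it is NOT the continuum limit and NOT the Clay problem.»  ABSOLUTE RULE (cell charter, verbatim): «No internally-minted
statement may enter as a cited fact. Every hypothesis is either kernel-proved in this package or a verbatim quotation of a PUBLISHED theorem with page
reference. The manuscript(s) under audit are NOT citable for their own disputed steps — they are the thing under adjudication; programme-internal
(2001/route/tribunal) claims are never citable.»  0 estimates; 0∕4 row-D1 binders (hW, hR, D1Tel, D1Rep); NOT (T-ID), NOT (J-a) complete, NOT SDF, NOT D1,
NOT BetaPertH, NOT continuum, NOT Clay.  D1 formalisation swarm LEAF PROVER 02 (b2b-balaban-beta-d1-formalise-leaf-02 gen 26), 2026-08-23.  No existing file touched.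
-/

noncomputable section

open scoped BigOperators

namespace Summit.QuantumFields.BalabanUV.Beta.FP.TorusCompositeIndexWardTwo

open Matrix Finset
open Literature.MathematicalPhysics.QuantumFieldTheory
open Literature.MathematicalPhysics.QuantumFieldTheory.Balaban1983to89
open Literature.MathematicalPhysics.QuantumFieldTheory.Balaban1983to89.Beta
open ExpKernelCalculus (MKer)
open B4TorusKernel.MultiPeriod (translate)
open B5Prop11Plancherel (fine)
open B6Lemma24Torus (pbox mem_pbox)
open AffineAveraging (Site box toSite unitVec)
open AveragingHessianKernelsRooted (vhSAt)
open AveragingMixedJetTables (vh₂SAt)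
open OneStepResolventKernel (Fib)
open Summit.QuantumFields.BalabanUV.Beta.BorderedHessian (stepScale stepScale_ne_zero)
open Summit.QuantumFields.BalabanUV.Beta.FP.KernelPeriodisationFib (Idx perF)
open Summit.QuantumFields.BalabanUV.Beta.FP.KernelPeriodisationFibLoc (dper)
open Summit.QuantumFields.BalabanUV.Beta.FP.TorusGaugeCovariance (tdelta tgrad)
open Summit.QuantumFields.BalabanUV.Beta.FP.TorusGaugeCovariancePairing (sum_tdelta_mul wrapPt_of_mem)
open Summit.QuantumFields.BalabanUV.Beta.FP.TorusGaugeCovarianceCoarse (coarsePt coarsePt_coe)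
open Summit.QuantumFields.BalabanUV.Beta.FP.TorusCompositeObjects
open Summit.QuantumFields.BalabanUV.Beta.FP.TorusCompositeCovariance (rootPt rootPt_coe itRoot itRoot_zero itRoot_succ)
open Summit.QuantumFields.BalabanUV.Beta.FP.TorusCompositeCovarianceOne (stepIns₁ compIns₁ compIns₁_zero prod_stepScale_mul_card_ne_zero')
open Summit.QuantumFields.BalabanUV.Beta.FP.TorusCompositeCovarianceTwoStep (stepIns₂)
open Summit.QuantumFields.BalabanUV.Beta.FP.TorusCompositeCovarianceTwo (compIns₂ compIns₂_zero card_box_cast)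
open Summit.QuantumFields.BalabanUV.Beta.FP.TorusCompositeIndexWardOne (stepIns₁_add stepIns₁_smul stepIns₁_pureGauge_fun compIns₁_add compIns₁_pureGauge_fun
  compRows_mulVec_tgrad_fun)
open Summit.QuantumFields.BalabanUV.Beta.FP.PeriodisedBorderIndexWardTwo (torus_T2_gauge_fst_of_presentation torus_T2_gauge_snd_of_presentation)

variable {d : ℕ}

/-! ## §1 One step: PART 1's bi-weighted forms at C1's slot maps; the first and second jets along a gauge-shifted weight -/

section OneStep

variable (M : Fin (d + 1) → ℕ) [∀ μ, NeZero (M μ)] (Lc : ℕ) [NeZero Lc] {r : Fin (d + 1) → ℕ}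
  {W : Fin (d + 1) → Site (d + 1) → Fin (d + 1) → Site (d + 1) → MKer (d + 1) (Fib d)}

/-- [folklore] in C1's slot maps the multiplier `a` rotates at the ROOT `rootPt a.1` of its block: `Σ_s tdelta F (Lc•a.1 + ρ) s · μ s = μ (rootPt a.1)`. -/
theorem sum_tdelta_coarsePt_add (hr : r ∈ box (d + 1) Lc) (lam : ↥(pbox (fine Lc M)) → ℝ) (a : ↥(pbox M) × Fin (d + 1)) :
    ∑ s : ↥(pbox (fine Lc M)), tdelta (fine Lc M) ((coarsePt M Lc a.1 : Site (d + 1)) + toSite r) s * lam s = lam (rootPt M Lc hr a.1) := by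
  rw [coarsePt_coe, ← rootPt_coe M Lc hr a.1, sum_tdelta_mul, wrapPt_of_mem]

/-- [folklore] **PART 1's BI-WEIGHTED FORM, GAUGE IN THE FIRST SLOT, AT C1's SLOT MAPS** (torus `F = fine Lc M`, rows `a ↦ (coarsePt M Lc a.1, inr a.2)`):
`Σ_b Σ_{b′} ((Dμ)_b · g b′) • T^{b,b′} = R_μ * stepIns₁ g − stepIns₁ g * E_μ`, `R_μ = diagonal (μ (rootPt a.1))`, `E_μ = diagonal (μ c.1)`. -/
theorem torus_T2_gauge_fst (hr : r ∈ box (d + 1) Lc)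
    (hW : W = fun κ' u' κ u x z a c => ∑' n : Site (d + 1), (1 / 2 : ℝ) * (vh₂SAt (toSite r) Lc κ u κ' (translate (fine Lc M) u' n) x z a c
      + vh₂SAt (toSite r) Lc κ' (translate (fine Lc M) u' n) κ u x z a c))
    (g : ↥(pbox (fine Lc M)) × Fin (d + 1) → ℝ) (lam : ↥(pbox (fine Lc M)) → ℝ) :
    (∑ b : ↥(pbox (fine Lc M)) × Fin (d + 1), ∑ b' : ↥(pbox (fine Lc M)) × Fin (d + 1),
        ((∑ s : ↥(pbox (fine Lc M)), tgrad (fine Lc M) (b.1, Sum.inl b.2) s * lam s) * g b') •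
          (perF (fine Lc M) (dper (fine Lc M) (W b'.2 (b'.1 : Site (d + 1)) b.2 (b.1 : Site (d + 1))))).submatrix
            (fun a : ↥(pbox M) × Fin (d + 1) => ((coarsePt M Lc a.1, Sum.inr a.2) : Idx (fine Lc M) (Fib d)))
            (fun c : ↥(pbox (fine Lc M)) × Fin (d + 1) => ((c.1, Sum.inl c.2) : Idx (fine Lc M) (Fib d))))
      = Matrix.diagonal (fun a : ↥(pbox M) × Fin (d + 1) => lam (rootPt M Lc hr a.1)) * stepIns₁ M Lc r g
        - stepIns₁ M Lc r g * Matrix.diagonal (fun c : ↥(pbox (fine Lc M)) × Fin (d + 1) => lam c.1) := by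
  have h := torus_T2_gauge_fst_of_presentation (M := fine Lc M) (M' := M) hr (fun _ => rfl) hW
    (fun a : ↥(pbox M) × Fin (d + 1) => (coarsePt M Lc a.1 : Site (d + 1))) (fun a => (coarsePt M Lc a.1).2) (fun a => a.2) g lam
  simp only [Subtype.coe_eta, sum_tdelta_coarsePt_add M Lc hr] at h
  rw [stepIns₁]
  exact h

/-- [folklore] **PART 1's BI-WEIGHTED FORM, GAUGE IN THE SECOND SLOT, AT C1's SLOT MAPS**: `Σ_b Σ_{b′} (g b · (Dμ)_{b′}) • T^{b,b′} = R_μ * stepIns₁ g − stepIns₁ g * E_μ`. -/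
theorem torus_T2_gauge_snd (hr : r ∈ box (d + 1) Lc)
    (hW : W = fun κ' u' κ u x z a c => ∑' n : Site (d + 1), (1 / 2 : ℝ) * (vh₂SAt (toSite r) Lc κ u κ' (translate (fine Lc M) u' n) x z a c
      + vh₂SAt (toSite r) Lc κ' (translate (fine Lc M) u' n) κ u x z a c))
    (g : ↥(pbox (fine Lc M)) × Fin (d + 1) → ℝ) (lam : ↥(pbox (fine Lc M)) → ℝ) :
    (∑ b : ↥(pbox (fine Lc M)) × Fin (d + 1), ∑ b' : ↥(pbox (fine Lc M)) × Fin (d + 1),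
        (g b * ∑ s : ↥(pbox (fine Lc M)), tgrad (fine Lc M) (b'.1, Sum.inl b'.2) s * lam s) •
          (perF (fine Lc M) (dper (fine Lc M) (W b'.2 (b'.1 : Site (d + 1)) b.2 (b.1 : Site (d + 1))))).submatrix
            (fun a : ↥(pbox M) × Fin (d + 1) => ((coarsePt M Lc a.1, Sum.inr a.2) : Idx (fine Lc M) (Fib d)))
            (fun c : ↥(pbox (fine Lc M)) × Fin (d + 1) => ((c.1, Sum.inl c.2) : Idx (fine Lc M) (Fib d))))
      = Matrix.diagonal (fun a : ↥(pbox M) × Fin (d + 1) => lam (rootPt M Lc hr a.1)) * stepIns₁ M Lc r g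
        - stepIns₁ M Lc r g * Matrix.diagonal (fun c : ↥(pbox (fine Lc M)) × Fin (d + 1) => lam c.1) := by
  have h := torus_T2_gauge_snd_of_presentation (M := fine Lc M) (M' := M) hr (fun _ => rfl) hW
    (fun a : ↥(pbox M) × Fin (d + 1) => (coarsePt M Lc a.1 : Site (d + 1))) (fun a => (coarsePt M Lc a.1).2) (fun a => a.2) g lam
  simp only [Subtype.coe_eta, sum_tdelta_coarsePt_add M Lc hr] at h
  rw [stepIns₁]
  exact h

/-- [folklore] **THE ONE-STEP FIRST JET ALONG A GAUGE-SHIFTED WEIGHT** (g22's `stepIns₁_add ∕ _smul ∕ _pureGauge_fun`):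
`stepIns₁ (w + σ•Dμ) = stepIns₁ w + (σ·c_ℓ)•(R_μ·Qstep_ℓ − Qstep_ℓ·E_μ)`. -/
theorem stepIns₁_shift_smul_fun (hr : r ∈ box (d + 1) Lc) (ℓ : ℕ) (w : ↥(pbox (fine Lc M)) × Fin (d + 1) → ℝ) (σ : ℝ) (lam : ↥(pbox (fine Lc M)) → ℝ) :
    stepIns₁ M Lc r (fun b : ↥(pbox (fine Lc M)) × Fin (d + 1) => w b + σ * ∑ s : ↥(pbox (fine Lc M)), tgrad (fine Lc M) (b.1, Sum.inl b.2) s * lam s)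
      = stepIns₁ M Lc r w
        + (σ * ((Lc : ℝ) ^ (d + 1) * stepScale d Lc ℓ)⁻¹) •
            (Matrix.diagonal (fun a : ↥(pbox M) × Fin (d + 1) => lam (rootPt M Lc hr a.1)) * Qstep Lc M ℓ r
              - Qstep Lc M ℓ r * Matrix.diagonal (fun b : ↥(pbox (fine Lc M)) × Fin (d + 1) => lam b.1)) := by
  rw [show (fun b : ↥(pbox (fine Lc M)) × Fin (d + 1) => w b + σ * ∑ s : ↥(pbox (fine Lc M)), tgrad (fine Lc M) (b.1, Sum.inl b.2) s * lam s)
      = w + σ • (fun b : ↥(pbox (fine Lc M)) × Fin (d + 1) => ∑ s : ↥(pbox (fine Lc M)), tgrad (fine Lc M) (b.1, Sum.inl b.2) s * lam s) from rfl,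
    stepIns₁_add, stepIns₁_smul, stepIns₁_pureGauge_fun M Lc hr ℓ lam, smul_smul]

/-- [folklore] **`stepIns₂_shift_smul_fun` — THE ONE-STEP SECOND JET ALONG A GAUGE-SHIFTED WEIGHT** (`r ∈ box`, ANY level `ℓ` for the constant): for every bond
weight `w`, scalar `σ` and torus gauge function `μ` on `F = fine Lc M`,
`stepIns₂ (w + σ•Dμ) = stepIns₂ w + σ • ((R_μ·stepIns₁ w − stepIns₁ w·E_μ) + (R_μ·stepIns₁ w − stepIns₁ w·E_μ)) + (σ·σ·c_ℓ) • (R_μ(R_μ Q − Q E_μ) − (R_μ Q − Q E_μ)E_μ)`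
(`Q = Qstep_ℓ`, `R_μ = diagonal (μ (rootPt a.1))`, `E_μ = diagonal (μ b.1)`, `c_ℓ = (Lc^{d+1}·stepScale d Lc ℓ)⁻¹`) — the bilinear expansion of I-3's `stepIns₂`, PART 1's
two slot laws for the cross terms, PART 1's first-slot law once more with g22's `stepIns₁_pureGauge_fun` for the gauge–gauge term. -/
theorem stepIns₂_shift_smul_fun (hr : r ∈ box (d + 1) Lc) (ℓ : ℕ) (w : ↥(pbox (fine Lc M)) × Fin (d + 1) → ℝ) (σ : ℝ) (lam : ↥(pbox (fine Lc M)) → ℝ) :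
    stepIns₂ M Lc r (fun b : ↥(pbox (fine Lc M)) × Fin (d + 1) => w b + σ * ∑ s : ↥(pbox (fine Lc M)), tgrad (fine Lc M) (b.1, Sum.inl b.2) s * lam s)
      = stepIns₂ M Lc r w
        + σ • ((Matrix.diagonal (fun a : ↥(pbox M) × Fin (d + 1) => lam (rootPt M Lc hr a.1)) * stepIns₁ M Lc r w
                  - stepIns₁ M Lc r w * Matrix.diagonal (fun b : ↥(pbox (fine Lc M)) × Fin (d + 1) => lam b.1))
              + (Matrix.diagonal (fun a : ↥(pbox M) × Fin (d + 1) => lam (rootPt M Lc hr a.1)) * stepIns₁ M Lc r w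
                  - stepIns₁ M Lc r w * Matrix.diagonal (fun b : ↥(pbox (fine Lc M)) × Fin (d + 1) => lam b.1)))
        + (σ * σ * ((Lc : ℝ) ^ (d + 1) * stepScale d Lc ℓ)⁻¹) •
            (Matrix.diagonal (fun a : ↥(pbox M) × Fin (d + 1) => lam (rootPt M Lc hr a.1))
                * (Matrix.diagonal (fun a : ↥(pbox M) × Fin (d + 1) => lam (rootPt M Lc hr a.1)) * Qstep Lc M ℓ r
                    - Qstep Lc M ℓ r * Matrix.diagonal (fun b : ↥(pbox (fine Lc M)) × Fin (d + 1) => lam b.1))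
              - (Matrix.diagonal (fun a : ↥(pbox M) × Fin (d + 1) => lam (rootPt M Lc hr a.1)) * Qstep Lc M ℓ r
                    - Qstep Lc M ℓ r * Matrix.diagonal (fun b : ↥(pbox (fine Lc M)) × Fin (d + 1) => lam b.1))
                * Matrix.diagonal (fun b : ↥(pbox (fine Lc M)) × Fin (d + 1) => lam b.1)) := by
  obtain ⟨W, hW⟩ : ∃ W : Fin (d + 1) → Site (d + 1) → Fin (d + 1) → Site (d + 1) → MKer (d + 1) (Fib d),
      W = fun κ' u' κ u x z a c => ∑' n : Site (d + 1), (1 / 2 : ℝ) * (vh₂SAt (toSite r) Lc κ u κ' (translate (fine Lc M) u' n) x z a c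
        + vh₂SAt (toSite r) Lc κ' (translate (fine Lc M) u' n) κ u x z a c) := ⟨_, rfl⟩
  -- I-3's `stepIns₂` in PART 1's bi-family letters
  have hS : ∀ v : ↥(pbox (fine Lc M)) × Fin (d + 1) → ℝ, stepIns₂ M Lc r v
      = ∑ b : ↥(pbox (fine Lc M)) × Fin (d + 1), ∑ b' : ↥(pbox (fine Lc M)) × Fin (d + 1), (v b * v b') •
          (perF (fine Lc M) (dper (fine Lc M) (W b'.2 (b'.1 : Site (d + 1)) b.2 (b.1 : Site (d + 1))))).submatrix
            (fun a : ↥(pbox M) × Fin (d + 1) => ((coarsePt M Lc a.1, Sum.inr a.2) : Idx (fine Lc M) (Fib d)))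
            (fun c : ↥(pbox (fine Lc M)) × Fin (d + 1) => ((c.1, Sum.inl c.2) : Idx (fine Lc M) (Fib d))) := fun v => by
    subst hW; rfl
  -- the bilinear expansion of the shifted pair of weights
  have hexp : ∀ (D : ↥(pbox (fine Lc M)) × Fin (d + 1) → ℝ)
      (Φ : ↥(pbox (fine Lc M)) × Fin (d + 1) → ↥(pbox (fine Lc M)) × Fin (d + 1) → Matrix (↥(pbox M) × Fin (d + 1)) (↥(pbox (fine Lc M)) × Fin (d + 1)) ℝ),
      ∑ b, ∑ b', ((w b + σ * D b) * (w b' + σ * D b')) • Φ b b'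
        = ∑ b, ∑ b', (w b * w b') • Φ b b' + (σ • ∑ b, ∑ b', (w b * D b') • Φ b b' + σ • ∑ b, ∑ b', (D b * w b') • Φ b b')
          + (σ * σ) • ∑ b, ∑ b', (D b * D b') • Φ b b' := fun D Φ => by
    simp only [Finset.smul_sum, smul_smul, ← Finset.sum_add_distrib, ← add_smul]
    exact Finset.sum_congr rfl fun b _ => Finset.sum_congr rfl fun b' _ => by ring_nf
  rw [hS (fun b : ↥(pbox (fine Lc M)) × Fin (d + 1) => w b + σ * ∑ s : ↥(pbox (fine Lc M)), tgrad (fine Lc M) (b.1, Sum.inl b.2) s * lam s), hS w,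
    hexp, torus_T2_gauge_snd M Lc hr hW w lam, torus_T2_gauge_fst M Lc hr hW w lam, torus_T2_gauge_fst M Lc hr hW _ lam,
    stepIns₁_pureGauge_fun M Lc hr ℓ lam]
  simp only [Matrix.smul_mul, Matrix.mul_smul, Matrix.mul_sub, Matrix.sub_mul, smul_sub, smul_add, smul_smul, Matrix.mul_assoc]

end OneStep

/-! ## §2 The composite second jet along a gauge-shifted direction, at every depth -/

section Tower

variable (Lc : ℕ) [NeZero Lc]

/-- [folklore] **(T-β-m) ORDER 2, THE INDUCTION STEP** (push-inside types; `compIns₂ … (n+1)`, `compIns₁ … (n+1)`, `compRows … (n+1)`, `itRoot … (n+1)` UNFOLDED by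
`rfl`): given the lower tower's shift law (`ih`), the three ♭ summands at `h + Dλ` — the top step's second jet along the transported direction
`C(h + Dλ) = Ch + σ_n•D(λ∘itRoot n)` (§1 `stepIns₂_shift_smul_fun`, weights `(θ_n∕σ_n)·σ_n = θ_n` and `(θ_n∕σ_n)·σ_n²·c_{lev 1} = 1`), twice the top step's first
jet (§1 `stepIns₁_shift_smul_fun`, `2θ_n·σ_n·c_{lev 1} = 2`) on the lower first jet (g22 `compIns₁_add ∕ _pureGauge_fun`), and the top rows on `ih` — regroup to
the depth-`(n+1)` law; every `R_low`-term cancels. -/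
theorem compIns₂_pureGauge_shift_step (n : ℕ) (M : Fin (d + 1) → ℕ) [∀ μ, NeZero (M μ)] (lev : ℕ → ℕ) (rs : ℕ → (Fin (d + 1) → ℕ))
    (hrs : ∀ k, rs k ∈ box (d + 1) Lc) (h : ↥(pbox (towerTorus Lc (fine Lc M) n)) × Fin (d + 1) → ℝ) (lam : ↥(pbox (towerTorus Lc (fine Lc M) n)) → ℝ)
    (ih : compIns₂ Lc (fine Lc M) (fun k => lev (k + 1)) (fun k => rs (k + 1)) n (fun b : ↥(pbox (towerTorus Lc (fine Lc M) n)) × Fin (d + 1) => h b + ∑ s : ↥(pbox (towerTorus Lc (fine Lc M) n)), tgrad (towerTorus Lc (fine Lc M) n) (b.1, Sum.inl b.2) s * lam s)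
      = compIns₂ Lc (fine Lc M) (fun k => lev (k + 1)) (fun k => rs (k + 1)) n h
        + ((Matrix.diagonal (fun a : ↥(pbox (fine Lc M)) × Fin (d + 1) => lam (itRoot Lc (fine Lc M) (fun k => rs (k + 1)) (fun k => hrs (k + 1)) n a.1)) * compIns₁ Lc (fine Lc M) (fun k => lev (k + 1)) (fun k => rs (k + 1)) n h - compIns₁ Lc (fine Lc M) (fun k => lev (k + 1)) (fun k => rs (k + 1)) n h * Matrix.diagonal (fun b : ↥(pbox (towerTorus Lc (fine Lc M) n)) × Fin (d + 1) => lam b.1))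
          + (Matrix.diagonal (fun a : ↥(pbox (fine Lc M)) × Fin (d + 1) => lam (itRoot Lc (fine Lc M) (fun k => rs (k + 1)) (fun k => hrs (k + 1)) n a.1)) * compIns₁ Lc (fine Lc M) (fun k => lev (k + 1)) (fun k => rs (k + 1)) n h - compIns₁ Lc (fine Lc M) (fun k => lev (k + 1)) (fun k => rs (k + 1)) n h * Matrix.diagonal (fun b : ↥(pbox (towerTorus Lc (fine Lc M) n)) × Fin (d + 1) => lam b.1)))
        + (Matrix.diagonal (fun a : ↥(pbox (fine Lc M)) × Fin (d + 1) => lam (itRoot Lc (fine Lc M) (fun k => rs (k + 1)) (fun k => hrs (k + 1)) n a.1)) * (Matrix.diagonal (fun a : ↥(pbox (fine Lc M)) × Fin (d + 1) => lam (itRoot Lc (fine Lc M) (fun k => rs (k + 1)) (fun k => hrs (k + 1)) n a.1)) * compRows Lc (fine Lc M) (fun k => lev (k + 1)) (fun k => rs (k + 1)) n - compRows Lc (fine Lc M) (fun k => lev (k + 1)) (fun k => rs (k + 1)) n * Matrix.diagonal (fun b : ↥(pbox (towerTorus Lc (fine Lc M) n)) × Fin (d + 1) => lam b.1)) - (Matrix.diagonal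 (fun a : ↥(pbox (fine Lc M)) × Fin (d + 1) => lam (itRoot Lc (fine Lc M) (fun k => rs (k + 1)) (fun k => hrs (k + 1)) n a.1)) * compRows Lc (fine Lc M) (fun k => lev (k + 1)) (fun k => rs (k + 1)) n - compRows Lc (fine Lc M) (fun k => lev (k + 1)) (fun k => rs (k + 1)) n * Matrix.diagonal (fun b : ↥(pbox (towerTorus Lc (fine Lc M) n)) × Fin (d + 1) => lam b.1)) * Matrix.diagonal (fun b : ↥(pbox (towerTorus Lc (fine Lc M) n)) × Fin (d + 1) => lam b.1))) :
    ((((Lc : ℝ) ^ (d + 1) * stepScale d Lc (lev 1)) * (∏ i ∈ range n, (stepScale d Lc (lev (i + 1 + 1)) * ((box (d + 1) Lc).card : ℝ)))⁻¹) * (∏ i ∈ range n, (stepScale d Lc (lev (i + 1 + 1)) * ((box (d + 1) Lc).card : ℝ)))⁻¹) • (stepIns₂ M Lc (rs 1) (compRows Lc (fine Lc M) (fun k => lev (k + 1)) (fun k => rs (k + 1)) n *ᵥ (fun b : ↥(pbox (towerTorus Lc (fine Lc M) n)) × Fin (d + 1) => h b + ∑ s : ↥(pbox (towerTorus Lc (fine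 Lc M) n)), tgrad (towerTorus Lc (fine Lc M) n) (b.1, Sum.inl b.2) s * lam s)) * compRows Lc (fine Lc M) (fun k => lev (k + 1)) (fun k => rs (k + 1)) n)
        + ((2 : ℝ) * (((Lc : ℝ) ^ (d + 1) * stepScale d Lc (lev 1)) * (∏ i ∈ range n, (stepScale d Lc (lev (i + 1 + 1)) * ((box (d + 1) Lc).card : ℝ)))⁻¹)) • (stepIns₁ M Lc (rs 1) (compRows Lc (fine Lc M) (fun k => lev (k + 1)) (fun k => rs (k + 1)) n *ᵥ (fun b : ↥(pbox (towerTorus Lc (fine Lc M) n)) × Fin (d + 1) => h b + ∑ s : ↥(pbox (towerTorus Lc (fine Lc M) n)), tgrad (towerTorus Lc (fine Lc M) n) (b.1, Sum.inl b.2) s * lam s)) * compIns₁ Lc (fine Lc M) (fun k => lev (k + 1)) (fun k => rs (k + 1)) n (fun b : ↥(pbox (towerTorus Lc (fine Lc M) n)) × Fin (d + 1) => h b + ∑ s : ↥(pbox (towerTorus Lc (fine Lc M) n)), tgrad (towerTorus Lc (fine Lc M) n) (b.1, Sum.inl b.2) s * lam s))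
        + Qstep Lc M (lev 1) (rs 1) * compIns₂ Lc (fine Lc M) (fun k => lev (k + 1)) (fun k => rs (k + 1)) n (fun b : ↥(pbox (towerTorus Lc (fine Lc M) n)) × Fin (d + 1) => h b + ∑ s : ↥(pbox (towerTorus Lc (fine Lc M) n)), tgrad (towerTorus Lc (fine Lc M) n) (b.1, Sum.inl b.2) s * lam s)
      = (((((Lc : ℝ) ^ (d + 1) * stepScale d Lc (lev 1)) * (∏ i ∈ range n, (stepScale d Lc (lev (i + 1 + 1)) * ((box (d + 1) Lc).card : ℝ)))⁻¹) * (∏ i ∈ range n, (stepScale d Lc (lev (i + 1 + 1)) * ((box (d + 1) Lc).card : ℝ)))⁻¹) • (stepIns₂ M Lc (rs 1) (compRows Lc (fine Lc M) (fun k => lev (k + 1)) (fun k => rs (k + 1)) n *ᵥ h) * compRows Lc (fine Lc M) (fun k => lev (k + 1)) (fun k => rs (k + 1)) n)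
          + ((2 : ℝ) * (((Lc : ℝ) ^ (d + 1) * stepScale d Lc (lev 1)) * (∏ i ∈ range n, (stepScale d Lc (lev (i + 1 + 1)) * ((box (d + 1) Lc).card : ℝ)))⁻¹)) • (stepIns₁ M Lc (rs 1) (compRows Lc (fine Lc M) (fun k => lev (k + 1)) (fun k => rs (k + 1)) n *ᵥ h) * compIns₁ Lc (fine Lc M) (fun k => lev (k + 1)) (fun k => rs (k + 1)) n h)
          + Qstep Lc M (lev 1) (rs 1) * compIns₂ Lc (fine Lc M) (fun k => lev (k + 1)) (fun k => rs (k + 1)) n h)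
        + ((Matrix.diagonal (fun a : ↥(pbox M) × Fin (d + 1) => lam (itRoot Lc (fine Lc M) (fun k => rs (k + 1)) (fun k => hrs (k + 1)) n (rootPt M Lc (hrs 1) a.1))) * ((((Lc : ℝ) ^ (d + 1) * stepScale d Lc (lev 1)) * (∏ i ∈ range n, (stepScale d Lc (lev (i + 1 + 1)) * ((box (d + 1) Lc).card : ℝ)))⁻¹) • (stepIns₁ M Lc (rs 1) (compRows Lc (fine Lc M) (fun k => lev (k + 1)) (fun k => rs (k + 1)) n *ᵥ h) * compRows Lc (fine Lc M) (fun k => lev (k + 1)) (fun k => rs (k + 1)) n) + Qstep Lc M (lev 1) (rs 1) * compIns₁ Lc (fine Lc M) (fun k => lev (k + 1)) (fun k => rs (k + 1)) n h) - ((((Lc : ℝ) ^ (d + 1) * stepScale d Lc (lev 1)) * (∏ i ∈ range n, (stepScale d Lc (lev (i + 1 + 1)) * ((box (d + 1) Lc).card : ℝ)))⁻¹) • (stepIns₁ M Lc (rs 1) (compRows Lc (fine Lc M) (fun k => lev (k + 1)) (fun k => rs (k + 1)) n *ᵥ h) * compRows Lc (fine Lc M) (fun k => lev (k + 1)) (fun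 k => rs (k + 1)) n) + Qstep Lc M (lev 1) (rs 1) * compIns₁ Lc (fine Lc M) (fun k => lev (k + 1)) (fun k => rs (k + 1)) n h) * Matrix.diagonal (fun b : ↥(pbox (towerTorus Lc (fine Lc M) n)) × Fin (d + 1) => lam b.1))
          + (Matrix.diagonal (fun a : ↥(pbox M) × Fin (d + 1) => lam (itRoot Lc (fine Lc M) (fun k => rs (k + 1)) (fun k => hrs (k + 1)) n (rootPt M Lc (hrs 1) a.1))) * ((((Lc : ℝ) ^ (d + 1) * stepScale d Lc (lev 1)) * (∏ i ∈ range n, (stepScale d Lc (lev (i + 1 + 1)) * ((box (d + 1) Lc).card : ℝ)))⁻¹) • (stepIns₁ M Lc (rs 1) (compRows Lc (fine Lc M) (fun k => lev (k + 1)) (fun k => rs (k + 1)) n *ᵥ h) * compRows Lc (fine Lc M) (fun k => lev (k + 1)) (fun k => rs (k + 1)) n) + Qstep Lc M (lev 1) (rs 1) * compIns₁ Lc (fine Lc M) (fun k => lev (k + 1)) (fun k => rs (k + 1)) n h) - ((((Lc : ℝ) ^ (d + 1) * stepScale d Lc (lev 1)) * (∏ i ∈ range n, (stepScale d Lc (lev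 (i + 1 + 1)) * ((box (d + 1) Lc).card : ℝ)))⁻¹) • (stepIns₁ M Lc (rs 1) (compRows Lc (fine Lc M) (fun k => lev (k + 1)) (fun k => rs (k + 1)) n *ᵥ h) * compRows Lc (fine Lc M) (fun k => lev (k + 1)) (fun k => rs (k + 1)) n) + Qstep Lc M (lev 1) (rs 1) * compIns₁ Lc (fine Lc M) (fun k => lev (k + 1)) (fun k => rs (k + 1)) n h) * Matrix.diagonal (fun b : ↥(pbox (towerTorus Lc (fine Lc M) n)) × Fin (d + 1) => lam b.1)))
        + (Matrix.diagonal (fun a : ↥(pbox M) × Fin (d + 1) => lam (itRoot Lc (fine Lc M) (fun k => rs (k + 1)) (fun k => hrs (k + 1)) n (rootPt M Lc (hrs 1) a.1))) * (Matrix.diagonal (fun a : ↥(pbox M) × Fin (d + 1) => lam (itRoot Lc (fine Lc M) (fun k => rs (k + 1)) (fun k => hrs (k + 1)) n (rootPt M Lc (hrs 1) a.1))) * (Qstep Lc M (lev 1) (rs 1) * compRows Lc (fine Lc M) (fun k => lev (k + 1)) (fun k => rs (k + 1)) n) - (Qstep Lc M (lev 1) (rs 1) * compRows Lc (fine Lc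 M) (fun k => lev (k + 1)) (fun k => rs (k + 1)) n) * Matrix.diagonal (fun b : ↥(pbox (towerTorus Lc (fine Lc M) n)) × Fin (d + 1) => lam b.1)) - (Matrix.diagonal (fun a : ↥(pbox M) × Fin (d + 1) => lam (itRoot Lc (fine Lc M) (fun k => rs (k + 1)) (fun k => hrs (k + 1)) n (rootPt M Lc (hrs 1) a.1))) * (Qstep Lc M (lev 1) (rs 1) * compRows Lc (fine Lc M) (fun k => lev (k + 1)) (fun k => rs (k + 1)) n) - (Qstep Lc M (lev 1) (rs 1) * compRows Lc (fine Lc M) (fun k => lev (k + 1)) (fun k => rs (k + 1)) n) * Matrix.diagonal (fun b : ↥(pbox (towerTorus Lc (fine Lc M) n)) × Fin (d + 1) => lam b.1)) * Matrix.diagonal (fun b : ↥(pbox (towerTorus Lc (fine Lc M) n)) × Fin (d + 1) => lam b.1)) := by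
  have hB : (box (d + 1) Lc).Nonempty := ⟨rs 0, hrs 0⟩
  have hσ : (∏ i ∈ range n, (stepScale d Lc (lev (i + 1 + 1)) * ((box (d + 1) Lc).card : ℝ))) ≠ 0 := prod_stepScale_mul_card_ne_zero' Lc hB (fun i => lev (i + 1 + 1)) n
  have hA : ((Lc : ℝ) ^ (d + 1) * stepScale d Lc (lev 1)) ≠ 0 := mul_ne_zero (pow_ne_zero _ (by exact_mod_cast NeZero.ne Lc)) (stepScale_ne_zero _)
  -- the scalar identities `(θ∕σ)·σ = θ`, `(θ∕σ)·σ²·c = 1`, `2θ·σ·c = 2`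
  have k1 : ((((Lc : ℝ) ^ (d + 1) * stepScale d Lc (lev 1)) * (∏ i ∈ range n, (stepScale d Lc (lev (i + 1 + 1)) * ((box (d + 1) Lc).card : ℝ)))⁻¹) * (∏ i ∈ range n, (stepScale d Lc (lev (i + 1 + 1)) * ((box (d + 1) Lc).card : ℝ)))⁻¹) * (∏ i ∈ range n, (stepScale d Lc (lev (i + 1 + 1)) * ((box (d + 1) Lc).card : ℝ))) = (((Lc : ℝ) ^ (d + 1) * stepScale d Lc (lev 1)) * (∏ i ∈ range n, (stepScale d Lc (lev (i + 1 + 1)) * ((box (d + 1) Lc).card : ℝ)))⁻¹) := inv_mul_cancel_right₀ hσ _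
  have hPP : (∏ i ∈ range n, (stepScale d Lc (lev (i + 1 + 1)) * ((box (d + 1) Lc).card : ℝ)))⁻¹ * (∏ i ∈ range n, (stepScale d Lc (lev (i + 1 + 1)) * ((box (d + 1) Lc).card : ℝ))) = 1 := inv_mul_cancel₀ hσ
  have hAA : ((Lc : ℝ) ^ (d + 1) * stepScale d Lc (lev 1)) * ((Lc : ℝ) ^ (d + 1) * stepScale d Lc (lev 1))⁻¹ = 1 := mul_inv_cancel₀ hA
  have k2 : ((((Lc : ℝ) ^ (d + 1) * stepScale d Lc (lev 1)) * (∏ i ∈ range n, (stepScale d Lc (lev (i + 1 + 1)) * ((box (d + 1) Lc).card : ℝ)))⁻¹) * (∏ i ∈ range n, (stepScale d Lc (lev (i + 1 + 1)) * ((box (d + 1) Lc).card : ℝ)))⁻¹) * ((∏ i ∈ range n, (stepScale d Lc (lev (i + 1 + 1)) * ((box (d + 1) Lc).card : ℝ))) * (∏ i ∈ range n, (stepScale d Lc (lev (i + 1 + 1)) * ((box (d + 1) Lc).card : ℝ))) * ((Lc : ℝ) ^ (d + 1) * stepScale d Lc (lev 1))⁻¹) = 1 := by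
    calc ((((Lc : ℝ) ^ (d + 1) * stepScale d Lc (lev 1)) * (∏ i ∈ range n, (stepScale d Lc (lev (i + 1 + 1)) * ((box (d + 1) Lc).card : ℝ)))⁻¹) * (∏ i ∈ range n, (stepScale d Lc (lev (i + 1 + 1)) * ((box (d + 1) Lc).card : ℝ)))⁻¹) * ((∏ i ∈ range n, (stepScale d Lc (lev (i + 1 + 1)) * ((box (d + 1) Lc).card : ℝ))) * (∏ i ∈ range n, (stepScale d Lc (lev (i + 1 + 1)) * ((box (d + 1) Lc).card : ℝ))) * ((Lc : ℝ) ^ (d + 1) * stepScale d Lc (lev 1))⁻¹)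
        = (((Lc : ℝ) ^ (d + 1) * stepScale d Lc (lev 1)) * ((Lc : ℝ) ^ (d + 1) * stepScale d Lc (lev 1))⁻¹) * ((∏ i ∈ range n, (stepScale d Lc (lev (i + 1 + 1)) * ((box (d + 1) Lc).card : ℝ)))⁻¹ * (∏ i ∈ range n, (stepScale d Lc (lev (i + 1 + 1)) * ((box (d + 1) Lc).card : ℝ)))) * ((∏ i ∈ range n, (stepScale d Lc (lev (i + 1 + 1)) * ((box (d + 1) Lc).card : ℝ)))⁻¹ * (∏ i ∈ range n, (stepScale d Lc (lev (i + 1 + 1)) * ((box (d + 1) Lc).card : ℝ)))) := by ring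
      _ = 1 := by rw [hPP, hAA, one_mul, one_mul]
  have k3 : (2 : ℝ) * (((Lc : ℝ) ^ (d + 1) * stepScale d Lc (lev 1)) * (∏ i ∈ range n, (stepScale d Lc (lev (i + 1 + 1)) * ((box (d + 1) Lc).card : ℝ)))⁻¹) * ((∏ i ∈ range n, (stepScale d Lc (lev (i + 1 + 1)) * ((box (d + 1) Lc).card : ℝ))) * ((Lc : ℝ) ^ (d + 1) * stepScale d Lc (lev 1))⁻¹) = 2 := by
    calc (2 : ℝ) * (((Lc : ℝ) ^ (d + 1) * stepScale d Lc (lev 1)) * (∏ i ∈ range n, (stepScale d Lc (lev (i + 1 + 1)) * ((box (d + 1) Lc).card : ℝ)))⁻¹) * ((∏ i ∈ range n, (stepScale d Lc (lev (i + 1 + 1)) * ((box (d + 1) Lc).card : ℝ))) * ((Lc : ℝ) ^ (d + 1) * stepScale d Lc (lev 1))⁻¹)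
        = 2 * ((((Lc : ℝ) ^ (d + 1) * stepScale d Lc (lev 1)) * ((Lc : ℝ) ^ (d + 1) * stepScale d Lc (lev 1))⁻¹) * ((∏ i ∈ range n, (stepScale d Lc (lev (i + 1 + 1)) * ((box (d + 1) Lc).card : ℝ)))⁻¹ * (∏ i ∈ range n, (stepScale d Lc (lev (i + 1 + 1)) * ((box (d + 1) Lc).card : ℝ))))) := by ring
      _ = 2 := by rw [hPP, hAA, one_mul, mul_one]
  -- the transported, shifted direction: `C(h + Dλ) = Ch + σ•D(λ∘itRoot)`
  have e1 : compRows Lc (fine Lc M) (fun k => lev (k + 1)) (fun k => rs (k + 1)) n *ᵥ (fun b : ↥(pbox (towerTorus Lc (fine Lc M) n)) × Fin (d + 1) => h b + ∑ s : ↥(pbox (towerTorus Lc (fine Lc M) n)), tgrad (towerTorus Lc (fine Lc M) n) (b.1, Sum.inl b.2) s * lam s)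
      = fun a : ↥(pbox (fine Lc M)) × Fin (d + 1) => (compRows Lc (fine Lc M) (fun k => lev (k + 1)) (fun k => rs (k + 1)) n *ᵥ h) a
          + (∏ i ∈ range n, (stepScale d Lc (lev (i + 1 + 1)) * ((box (d + 1) Lc).card : ℝ))) * ∑ t : ↥(pbox (fine Lc M)), tgrad (fine Lc M) (a.1, Sum.inl a.2) t * lam (itRoot Lc (fine Lc M) (fun k => rs (k + 1)) (fun k => hrs (k + 1)) n t) := by
    rw [show (fun b : ↥(pbox (towerTorus Lc (fine Lc M) n)) × Fin (d + 1) => h b + ∑ s : ↥(pbox (towerTorus Lc (fine Lc M) n)), tgrad (towerTorus Lc (fine Lc M) n) (b.1, Sum.inl b.2) s * lam s)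
        = h + (fun b : ↥(pbox (towerTorus Lc (fine Lc M) n)) × Fin (d + 1) => ∑ s : ↥(pbox (towerTorus Lc (fine Lc M) n)), tgrad (towerTorus Lc (fine Lc M) n) (b.1, Sum.inl b.2) s * lam s) from rfl,
      Matrix.mulVec_add, compRows_mulVec_tgrad_fun Lc n (fine Lc M) _ _ (fun k => hrs (k + 1)) lam]
    rfl
  -- summand 1: the top step's second jet (§1)
  have S1 := stepIns₂_shift_smul_fun M Lc (hrs 1) (lev 1) (compRows Lc (fine Lc M) (fun k => lev (k + 1)) (fun k => rs (k + 1)) n *ᵥ h) (∏ i ∈ range n, (stepScale d Lc (lev (i + 1 + 1)) * ((box (d + 1) Lc).card : ℝ)))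
    (fun t : ↥(pbox (fine Lc M)) => lam (itRoot Lc (fine Lc M) (fun k => rs (k + 1)) (fun k => hrs (k + 1)) n t))
  -- summand 2: the top step's first jet (§1) on the lower composite's first jet (g22)
  have S2a := stepIns₁_shift_smul_fun M Lc (hrs 1) (lev 1) (compRows Lc (fine Lc M) (fun k => lev (k + 1)) (fun k => rs (k + 1)) n *ᵥ h) (∏ i ∈ range n, (stepScale d Lc (lev (i + 1 + 1)) * ((box (d + 1) Lc).card : ℝ)))
    (fun t : ↥(pbox (fine Lc M)) => lam (itRoot Lc (fine Lc M) (fun k => rs (k + 1)) (fun k => hrs (k + 1)) n t))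
  have S2b : compIns₁ Lc (fine Lc M) (fun k => lev (k + 1)) (fun k => rs (k + 1)) n (fun b : ↥(pbox (towerTorus Lc (fine Lc M) n)) × Fin (d + 1) => h b + ∑ s : ↥(pbox (towerTorus Lc (fine Lc M) n)), tgrad (towerTorus Lc (fine Lc M) n) (b.1, Sum.inl b.2) s * lam s) = compIns₁ Lc (fine Lc M) (fun k => lev (k + 1)) (fun k => rs (k + 1)) n h + (Matrix.diagonal (fun a : ↥(pbox (fine Lc M)) × Fin (d + 1) => lam (itRoot Lc (fine Lc M) (fun k => rs (k + 1)) (fun k => hrs (k + 1)) n a.1)) * compRows Lc (fine Lc M) (fun k => lev (k + 1)) (fun k => rs (k + 1)) n - compRows Lc (fine Lc M) (fun k => lev (k + 1)) (fun k => rs (k + 1)) n * Matrix.diagonal (fun b : ↥(pbox (towerTorus Lc (fine Lc M) n)) × Fin (d + 1) => lam b.1)) := by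
    show compIns₁ Lc (fine Lc M) (fun k => lev (k + 1)) (fun k => rs (k + 1)) n (h + fun b : ↥(pbox (towerTorus Lc (fine Lc M) n)) × Fin (d + 1) => ∑ s : ↥(pbox (towerTorus Lc (fine Lc M) n)), tgrad (towerTorus Lc (fine Lc M) n) (b.1, Sum.inl b.2) s * lam s) = _
    rw [compIns₁_add, compIns₁_pureGauge_fun Lc n (fine Lc M) _ _ (fun k => hrs (k + 1)) lam]
  rw [e1, S1, S2a, S2b, ih]
  simp only [Matrix.add_mul, Matrix.mul_add, Matrix.sub_mul, Matrix.mul_sub, Matrix.smul_mul, Matrix.mul_smul, smul_add, smul_sub, smul_smul,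
    Matrix.mul_assoc, k1, k2, k3, one_smul]
  module

/-- [folklore] **`compIns₂_pureGauge_shift` — (T-β-m) ORDER 2: THE COMPOSITE SECOND-ORDER INSERTION JET ALONG A GAUGE-SHIFTED DIRECTION, AT EVERY DEPTH**:
`compIns₂ … n (h + Dλ) = compIns₂ … n h + ((R·compIns₁ … n h − compIns₁ … n h·E) + (R·compIns₁ … n h − compIns₁ … n h·E)) + (R(R C − C E) − (R C − C E)E)`,
`C = compRows … n`, `E = diagonal (λ b.1)` (a field leg rotates at the BASE of its bond on the finest torus), `R = diagonal (λ (itRoot n a.1))` (a multiplier at the ITERATED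
ROOT of its coarse site) — NO constants: OUR ♭ composite second jet (I-4) is EXACTLY gauge-covariant at order 2, the order-2 twin of g22's `compIns₁_pureGauge_fun`
(`compIns₁ … n (Dλ) = R C − C E`).  Depth `0`: `0 = 0`; the step is `compIns₂_pureGauge_shift_step`. -/
theorem compIns₂_pureGauge_shift :
    ∀ (n : ℕ) (M : Fin (d + 1) → ℕ) [∀ μ, NeZero (M μ)] (lev : ℕ → ℕ) (rs : ℕ → (Fin (d + 1) → ℕ)) (hrs : ∀ k, rs k ∈ box (d + 1) Lc)
      (h : ↥(pbox (towerTorus Lc M n)) × Fin (d + 1) → ℝ) (lam : ↥(pbox (towerTorus Lc M n)) → ℝ),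
      compIns₂ Lc M lev rs n (fun b : ↥(pbox (towerTorus Lc M n)) × Fin (d + 1) =>
          h b + ∑ s : ↥(pbox (towerTorus Lc M n)), tgrad (towerTorus Lc M n) (b.1, Sum.inl b.2) s * lam s)
        = compIns₂ Lc M lev rs n h
          + ((Matrix.diagonal (fun a : ↥(pbox M) × Fin (d + 1) => lam (itRoot Lc M rs hrs n a.1)) * compIns₁ Lc M lev rs n h
                - compIns₁ Lc M lev rs n h * Matrix.diagonal (fun b : ↥(pbox (towerTorus Lc M n)) × Fin (d + 1) => lam b.1))
            + (Matrix.diagonal (fun a : ↥(pbox M) × Fin (d + 1) => lam (itRoot Lc M rs hrs n a.1)) * compIns₁ Lc M lev rs n h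
                - compIns₁ Lc M lev rs n h * Matrix.diagonal (fun b : ↥(pbox (towerTorus Lc M n)) × Fin (d + 1) => lam b.1)))
          + (Matrix.diagonal (fun a : ↥(pbox M) × Fin (d + 1) => lam (itRoot Lc M rs hrs n a.1))
                * (Matrix.diagonal (fun a : ↥(pbox M) × Fin (d + 1) => lam (itRoot Lc M rs hrs n a.1)) * compRows Lc M lev rs n
                    - compRows Lc M lev rs n * Matrix.diagonal (fun b : ↥(pbox (towerTorus Lc M n)) × Fin (d + 1) => lam b.1))
              - (Matrix.diagonal (fun a : ↥(pbox M) × Fin (d + 1) => lam (itRoot Lc M rs hrs n a.1)) * compRows Lc M lev rs n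
                    - compRows Lc M lev rs n * Matrix.diagonal (fun b : ↥(pbox (towerTorus Lc M n)) × Fin (d + 1) => lam b.1))
                * Matrix.diagonal (fun b : ↥(pbox (towerTorus Lc M n)) × Fin (d + 1) => lam b.1))
  | 0, M, _, lev, rs, hrs, h, lam => by
    show (0 : Matrix (↥(pbox M) × Fin (d + 1)) (↥(pbox M) × Fin (d + 1)) ℝ)
      = 0 + ((Matrix.diagonal (fun a : ↥(pbox M) × Fin (d + 1) => lam a.1) * (0 : Matrix (↥(pbox M) × Fin (d + 1)) (↥(pbox M) × Fin (d + 1)) ℝ)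
                - (0 : Matrix (↥(pbox M) × Fin (d + 1)) (↥(pbox M) × Fin (d + 1)) ℝ) * Matrix.diagonal (fun b : ↥(pbox M) × Fin (d + 1) => lam b.1))
              + (Matrix.diagonal (fun a : ↥(pbox M) × Fin (d + 1) => lam a.1) * (0 : Matrix (↥(pbox M) × Fin (d + 1)) (↥(pbox M) × Fin (d + 1)) ℝ)
                - (0 : Matrix (↥(pbox M) × Fin (d + 1)) (↥(pbox M) × Fin (d + 1)) ℝ) * Matrix.diagonal (fun b : ↥(pbox M) × Fin (d + 1) => lam b.1)))
          + (Matrix.diagonal (fun a : ↥(pbox M) × Fin (d + 1) => lam a.1)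
                * (Matrix.diagonal (fun a : ↥(pbox M) × Fin (d + 1) => lam a.1) * (1 : Matrix (↥(pbox M) × Fin (d + 1)) (↥(pbox M) × Fin (d + 1)) ℝ)
                    - (1 : Matrix (↥(pbox M) × Fin (d + 1)) (↥(pbox M) × Fin (d + 1)) ℝ) * Matrix.diagonal (fun b : ↥(pbox M) × Fin (d + 1) => lam b.1))
              - (Matrix.diagonal (fun a : ↥(pbox M) × Fin (d + 1) => lam a.1) * (1 : Matrix (↥(pbox M) × Fin (d + 1)) (↥(pbox M) × Fin (d + 1)) ℝ)
                    - (1 : Matrix (↥(pbox M) × Fin (d + 1)) (↥(pbox M) × Fin (d + 1)) ℝ) * Matrix.diagonal (fun b : ↥(pbox M) × Fin (d + 1) => lam b.1))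
                * Matrix.diagonal (fun b : ↥(pbox M) × Fin (d + 1) => lam b.1))
    simp only [Matrix.mul_one, Matrix.one_mul, sub_self, Matrix.mul_zero, Matrix.zero_mul, add_zero]
  | n + 1, M, _, lev, rs, hrs, h, lam =>
    compIns₂_pureGauge_shift_step Lc n M lev rs hrs h lam
      (compIns₂_pureGauge_shift n (fine Lc M) (fun k => lev (k + 1)) (fun k => rs (k + 1)) (fun k => hrs (k + 1)) h lam)

end Tower

end Summit.QuantumFields.BalabanUV.Beta.FP.TorusCompositeIndexWardTwo

end
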